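import Summits.HodgeConjecture.CorCM.Census.TwistTwoColumnLaw
import Summits.HodgeConjecture.CorCM.Census.ComplementFacesGenerate
import Summits.HodgeConjecture.CorCM.Census.CyclicFacesGenerate

/-!
# Uniform twist generation, XIX: THE TWISTED CENSUS IS COMPLETE — `μ(G, c) = φ₂(G, c)` along EVERY datum `G ≃ ℤ/2^{j+1} × B`
# (`j ≥ 0`, `B` any finite group)

COR-CM (cell `pub-hodgecm2`), count-neutral kernel combinatorics by the binder seat b09 (gen 37; lane UNIFORM TWIST GENERATION, part XIX — the
capstone), on parts IX, XV, XVIII (this lineage: `complete_law`, `exact_law_two`, `…_card_eq_fibreTwo_of_two_le`), seat b23ʼs complemented law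
(`Census/ComplementFacesGenerate.exists_gfaces_generate_of_cpl_card_eq`, the case `j = 0`) and seat b23ʼs cyclic law
(`Census/CyclicFacesGenerate.exists_gfaces_generate_of_isCyclic_card_eq`, the case `|B| = 1`) used BY NAME.  Theorems only: no definition, no
`decide`, no certificate, no named fact, no `sorry`.
HONEST FRAMING: `HC_CM` is NOT proved, here or anywhere in the tree; nothing here is a period or a headline.

**MAIN THEOREM** (`exists_gfaces_generate_card_eq_fibreTwo_all`, `isLeast_card_gfaces_generate`).  Let `G` be a finite group with a datum
`θ : G ≃ ℤ/2n × B` (`θ (PQ) = θ P + θ Q`, `θ c = (n, 0)`) of 2-power level `n = 2^j`, `j ≥ 0` — i.e. `G ≅ ℤ/2^{j+1} × B` with `c` the involution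
of the cyclic factor, `B` ANY finite group (every finite group with a central cyclic direct factor of 2-power order containing `c`; for abelian
`G` this is the normal form of an arbitrary involution `c`, `2^j` = the height of `c`).  Then the least number of rank-four face relations whose
base changes generate the integer Hodge lattice of `(G, c)` modulo the pairs is EXACTLY the coinvariant invariant **`φ₂(G, c)`**
(`Census/CoinvariantFibre.fibreTwo`), and no finite family of integer Hodge vectors of fewer members generates: **`μ(G, c) = φ₂(G, c)`** —
the GRAND CONJECTURE of the lane note (`HOME/pub-hodgecm2-b09/lean-g32/QUARTIC-TWIST.md` PART V) on the whole twisted column.  By the fibre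
laws `φ₂` is explicit: `β − 1 − [|B| even]` (`j = 0`, `Census/CoinvariantComplementLaw`), `β − 1 − [∃ t ∈ B, 2^{j+1} ∣ ord t]` (`j ≥ 1`,
`Census/CoinvariantTwistLaw`).  Cases of the proof: `j = 0` — `θ⁻¹(0 × B)` is a complement of `c` (seat b23ʼs complemented law); `j ≥ 1`,
`|B| = 1` — `G` is cyclic (seat b23ʼs cyclic law); `j ≥ 1`, `|B| ≥ 2` — parts IX/XV/XVIII of this lineage.

## References
* [Pohlmann1968] H. Pohlmann, Algebraic cycles on abelian varieties of complex multiplication type, Ann. of Math. 88 (1968), Thm 1.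
* [Milne1999] J. S. Milne, Lefschetz motives and the Tate conjecture, Compositio Math. 117 (1999), Prop. 2.1, p. 54.
-/

namespace Summit.HodgeConjecture.CorCM.Census.TwistGeneration

open Finset
open Summit.HodgeConjecture.CorCM.Prior.AllgGroup.RfwfAllgGroup
open Summit.HodgeConjecture.CorCM.Census.BlockParity
open Summit.HodgeConjecture.CorCM.Census.Coinvariant

noncomputable section

variable {G : Type*} [Group G] [Fintype G] [DecidableEq G] {c : G}
variable {B : Type} [AddGroup B] [Fintype B]
variable {n : ℕ} [NeZero n] (θ : G ≃ ZMod (2 * n) × B)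
variable (hθ : ∀ P Q : G, θ (P * Q) = θ P + θ Q) (hθc : θ c = (((n : ℕ) : ZMod (2 * n)), 0))

/-! ## §1 The two degenerate cases: level one (a complement), trivial column group (cyclic) -/

omit [Fintype G] [DecidableEq G] [Fintype B] in
include hθ hθc in
/-- **At level `n = 1` the subgroup `θ⁻¹(0 × B)` is a complement of `c`.** [folklore] -/
theorem isComplement_of_level_one (hn : n = 1) {Bs : Subgroup G} (hBs : ∀ g : G, g ∈ Bs ↔ (θ g).1 = 0) :
    ∀ x : G, x ∈ Bs ↔ c * x ∉ Bs := by
  subst hn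
  intro x
  rw [hBs, hBs, fst_c_mul θ hθ hθc]
  have hv := ZMod.val_lt (θ x).1
  have h1 : (((1 : ℕ) : ℕ) : ZMod (2 * 1)).val = 1 := ZMod.val_cast_of_lt (by norm_num)
  constructor
  · intro h0 h1'
    have := congrArg ZMod.val h1'
    rw [h0, zero_add, h1, ZMod.val_zero] at this
    exact one_ne_zero this
  · intro h
    by_contra h0
    have hval : ((θ x).1).val = 1 := by
      have : ((θ x).1).val ≠ 0 := fun e => h0 ((ZMod.val_eq_zero _).mp e)
      omega
    apply h
    apply ZMod.val_injective
    rw [ZMod.val_add, hval, h1, ZMod.val_zero]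

omit [Fintype G] [DecidableEq G] in
include hθ in
/-- **With a trivial column group, `G` is cyclic** (generated by `u = θ⁻¹(1, 0)`). [folklore] -/
theorem isCyclic_of_card_eq_one (hB : Fintype.card B = 1) : IsCyclic G := by
  haveI : Subsingleton B := Fintype.card_le_one_iff_subsingleton.mp hB.le
  obtain ⟨Bs, hBs⟩ := exists_bSub θ hθ
  refine ⟨⟨θ.symm (1, 0), fun x => ?_⟩⟩
  obtain ⟨i, b, hb, rfl⟩ := exists_u_pow_mul θ hθ hBs x
  have hb1 : b = 1 := θ.injective (by
    rw [map_one_eq θ hθ]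
    exact Prod.ext ((hBs b).mp hb) (Subsingleton.elim _ _))
  refine ⟨(i : ℤ), ?_⟩
  show θ.symm (1, 0) ^ (i : ℤ) = θ.symm (1, 0) ^ i * b
  rw [zpow_natCast, hb1, mul_one]

/-! ## §2 `μ = φ₂` along every datum of 2-power level -/

include θ hθ hθc in
/-- **MAIN THEOREM — THE TWISTED CENSUS: `μ(G, c) = φ₂(G, c)`.**  Along a datum `θ : G ≃ ℤ/2n × B` with `n = 2^j` (`j ≥ 0`, `B` any finite group)
there is a family of rank-four face relations with EXACTLY `φ₂(G, c)` members whose base changes generate the integer Hodge lattice modulo the pairs,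
and every finite family of integer Hodge vectors whose base changes generate the face relations modulo pairs has at least `φ₂(G, c)` members.
[folklore] -/
theorem exists_gfaces_generate_card_eq_fibreTwo_all (hc2 : c * c = 1) {j : ℕ} (hj : n = 2 ^ j) :
    (∃ S : Finset (CMF G c →₀ ℤ), (↑S ⊆ gfaceSet G c hc2) ∧ S.card = fibreTwo c hc2 ∧
        hodgeSpan c hc2 ≤ Submodule.span ℤ (pairSet c) ⊔ Submodule.span ℤ (translates c S)) ∧
      (∀ S : Finset (CMF G c →₀ ℤ), (↑S : Set (CMF G c →₀ ℤ)) ⊆ hodgeSpan c hc2 →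
        gfaceSet G c hc2 ⊆ ↑(Submodule.span ℤ (pairSet c) ⊔ Submodule.span ℤ (translates c S)) → fibreTwo c hc2 ≤ S.card) := by
  have hcen := mul_comm_c θ hθ hθc
  have hc1 := c_ne_one θ hθ hθc
  refine ⟨?_, fun S hS hX => fibreTwo_le_card c hc2 hcen S _ le_rfl hS hX⟩
  rcases Nat.eq_zero_or_pos j with hj0 | hjpos
  · -- level one: `θ⁻¹(0 × B)` is a complement of `c`
    subst hj0
    rw [pow_zero] at hj
    obtain ⟨Bs, hBs⟩ := exists_bSub θ hθ
    have hA := isComplement_of_level_one θ hθ hθc hj hBs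
    obtain ⟨S, hS, -, hfib, hgen⟩ := ComplementFaces.exists_gfaces_generate_of_cpl_card_eq c hA hc2 hc1 hcen (cst θ hθ hθc 0)
    exact ⟨S, hS, hfib.symm, hgen⟩
  · have hn : 2 ≤ n := by
      rw [hj]
      calc 2 = 2 ^ 1 := by norm_num
        _ ≤ 2 ^ j := Nat.pow_le_pow_right (by norm_num) hjpos
    by_cases hB : 2 ≤ Fintype.card B
    · exact (exists_gfaces_generate_card_eq_fibreTwo_of_two_le θ hθ hθc hc2 hj hn hB).1
    · -- trivial column group: `G` is cyclic
      have hB1 : Fintype.card B = 1 := by have := Fintype.card_pos (α := B); omega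
      haveI := isCyclic_of_card_eq_one θ hθ hB1
      obtain ⟨S, hS, -, hfib, hgen⟩ := CyclicFaces.exists_gfaces_generate_of_isCyclic_card_eq c hc2 hc1
      exact ⟨S, hS, hfib.symm, hgen⟩

include θ hθ hθc in
/-- **`μ(G, c) = φ₂(G, c)` as a least element**: along a datum of 2-power level, `φ₂(G, c)` is the least size of a set of rank-four face relations
whose base changes generate the integer Hodge lattice modulo the pairs. [folklore] -/
theorem isLeast_card_gfaces_generate (hc2 : c * c = 1) {j : ℕ} (hj : n = 2 ^ j) :
    IsLeast {m : ℕ | ∃ S : Finset (CMF G c →₀ ℤ), (↑S ⊆ gfaceSet G c hc2) ∧ S.card = m ∧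
      hodgeSpan c hc2 ≤ Submodule.span ℤ (pairSet c) ⊔ Submodule.span ℤ (translates c S)} (fibreTwo c hc2) := by
  obtain ⟨⟨S, hS, hcard, hgen⟩, hfloor⟩ := exists_gfaces_generate_card_eq_fibreTwo_all θ hθ hθc hc2 hj
  refine ⟨⟨S, hS, hcard, hgen⟩, ?_⟩
  rintro m ⟨S', hS', rfl, hgen'⟩
  exact hfloor S' (hS'.trans (gfaceSet_subset_hodgeSpan c hc2)) fun y hy => hgen' (gfaceSet_subset_hodgeSpan c hc2 hy)

end

end Summit.HodgeConjecture.CorCM.Census.TwistGeneration
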